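import Summits.ABC.IUTFork.LanaThetaLink
import Summits.ABC.IUTFork.LanaDegreesBridge
import HarnessLib

/-!
# L-LANA objects IV bis: the Θ-link between the PRINTED Θ-pilot and `q`-pilot BPSs (LANA §4.2 (c), §7.1)

Record-only file (D-0012) of the abc-iut cell (seat abc-iut-c312-4, L-LANA level; assembles N6 (BPS,
`LanaGMData`), N7 (`LanaDegrees`/`LanaDegreesBridge`), N8 (Θ-pilot BPS, skel XIV `ForkHexagon`) and N16
(`LanaThetaLink`)); TAKES NO SIDE on [IUTchIII] Cor. 3.12. For a number field with `q`-pilot input `Q`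
(places `V = V^bad ⊔ V^good ⊔ V^arc`, `ord_v(q_v) > 0`) and ANY reference étale-unit family `ref` over `V`
(e.g. the constructed `ℚ_p`/`K_v` data of `LanaPadicGalois`/`LanaLocalField` at the finite places):

* `qPilotBPS Q ref` — §4.2 (c) "the `q`-pilot value-group BPS in the étale Hodge theater `H`, and a BPS
  having this type of value-group portion is called a `q`-pilot BPS": étale-unit portion = the reference
  `B(H)` (`EtaleUnitBPS.std`), value-group portion = XIV's `qBPS` on the PRINTED degrees;
* `thetaPilotBPS Q ref` — §7.1 (a): value-group portion = XIV's `thetaBPS` with LANA's `s = Σj²/ℓ⋇`;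
* `printedThetaLink Q ref : ThetaLink` — §7.1 (b): the two have the same product formula (XIV
  `thetaBPS_PF`), so the Θ-link datum EXISTS for the printed pilots; its gluing is nonempty (Rem. 8.2.1),
  its value-group component is XIV's unique `thetaLink` (`printedThetaLink_valueIso`), along which the
  Θ-side degree of the Θ-pilot is `s ·` (its `q`-side degree) — the §10.2 scaling for the printed objects.

[cite: LANA2026Report, §4.2 (c) p. 26, §7.1 (a),(b) pp. 37–38, §10.2 p. 47] NOT here: any judgement.
-/

noncomputable section

namespace Summit.ABC
namespace IUTFork
namespace QPilotInput

open NumberField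

variable {F : Type} [Field F] [NumberField F] (Q : QPilotInput F) (ref : Q.V → GMDataK)

/-- **§4.2 (c)**: the `q`-pilot BPS of the Hodge theater — reference étale-unit portion `B(H)`, value-group
portion the PRINTED `q`-pilot value-group BPS (`C = ℝ`, `φ_v = deg(q̲_v)/deg(p_v)/2π`).
[cite: LANA2026Report, §4.2 (c) p. 26] -/
def qPilotBPS : LanaBPS ref Q.badIn := ⟨EtaleUnitBPS.std ref, Q.toLocalDegrees.qBPS⟩

/-- **§7.1 (a)**: the Θ-pilot BPS — same étale-unit portion, value-group portion XIV's Θ-pilot BPS with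
`ψ_v(Θ_v) = s · d_v`, `s = (1² + ⋯ + (ℓ⋇)²)/ℓ⋇`. [cite: LANA2026Report, §7.1 (a) pp. 37–38] -/
def thetaPilotBPS : LanaBPS ref Q.badIn :=
  ⟨EtaleUnitBPS.std ref, Q.toLocalDegrees.thetaBPS Q.toLocalDegrees.s_pos⟩

/-- **§7.1 (b) for the printed pilots**: the Θ-link datum `†B_Θ → ‡B_q` exists — the product formulas agree
(XIV `thetaBPS_PF`). [cite: LANA2026Report, §7.1 (b) p. 38] -/
def printedThetaLink : ThetaLink ref Q.badIn :=
  ⟨Q.thetaPilotBPS ref, Q.qPilotBPS ref, Q.toLocalDegrees.thetaBPS_PF Q.toLocalDegrees.s_pos⟩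

/-- Its gluing (the full poly-isomorphism) is nonempty (Rem. 8.2.1 for the printed objects).
[cite: LANA2026Report, Rem. 8.2.1 p. 42] -/
theorem printedThetaLink_gluing_nonempty : (Q.printedThetaLink ref).gluing.Nonempty :=
  (Q.printedThetaLink ref).gluing_nonempty

/-- Its value-group component is XIV's (unique) `thetaLink`. [cite: LANA2026Report, §7.1 (b) (b) p. 38] -/
theorem printedThetaLink_valueIso :
    (Q.printedThetaLink ref).valueIso = Q.toLocalDegrees.thetaLink Q.toLocalDegrees.s_pos :=
  Q.toLocalDegrees.thetaLink_unique Q.toLocalDegrees.s_pos _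

/-- **§10.2 for the printed objects**: along the Θ-link, the Θ-side degree of any element of `C_Θ` is
`s ·` its `q`-side degree (XIV `hexagon_theta_route` transported through `printedThetaLink_valueIso`).
[cite: LANA2026Report, §10.2 p. 47] -/
theorem printedThetaLink_scaling (x : (Q.thetaPilotBPS ref).val.C) :
    Q.toLocalDegrees.thetaDeg Q.toLocalDegrees.s_pos x =
      Q.toLocalDegrees.s * Q.toLocalDegrees.qDeg ((Q.printedThetaLink ref).valueIso.toEquiv x) := by
  rw [printedThetaLink_valueIso]
  exact Q.toLocalDegrees.hexagon_theta_route Q.toLocalDegrees.s_pos x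

end QPilotInput
end IUTFork
end Summit.ABC

end
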